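import Summits.BirchSwinnertonDyer.BirchSwinnertonDyer.Theorems.CongruentShaFreeCutTwoAdicSelmerFiniteCorank
import Summits.BirchSwinnertonDyer.BirchSwinnertonDyer.Theorems.CongruentShaFreeCutTwoAdicSelmerFinite
import Summits.BirchSwinnertonDyer.BirchSwinnertonDyer.Theorems.RamifiedSevenEllipticUnitsStrictControlCastellaBridge
import Summits.BirchSwinnertonDyer.Rank1Residual.X11b.KummerLocalTorsionSaturation
import Literature.NumberTheory.EllipticCurves.SelmerCorankAssembly
import Literature.NumberTheory.EllipticCurves.MordellWeilRankZeroProofs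

/-! # Route `CongruentShaFreeCut` (rung S2) — crux `RankPosOfTwoSelmerCorankOne`
(stmt-BirchSwinnertonDyer-19079), line `heegner-field-links` v5: the REGISTERED algebra stub
**`stub_selmerAcBaseFinite_of_resCorankOne`** (token-identical on the S2b sister crux
stmt-BirchSwinnertonDyer-19159), PROVED modulo its own two textbook binders

Cell `bsd-cn100`, prover seat `bsd-cn100-transfer-2` g3. Supports stmt-BirchSwinnertonDyer-19079 (stub
credit; the crux itself stays the route's declared RESIDUAL). HONEST FRAMING: label (B) — the theorem
CARRIES Poitou–Tate (`poitouTate_sum_localTatePairing_eq_zero K`, Milne ADT I 4.10(b)/2.3) and the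
local Euler–Poincaré characteristic (`localEulerPoincareCharacteristic (K_v)`, Milne I 2.8, a tree
theorem) as HYPOTHESES, exactly as registered; nothing about (res), Link B, crux A/B, the leaf, the
congruent number problem, Sylvester or any case of BSD is claimed.

## Proof (assembly of landed pieces + the currency bridge proved here)

The finiteness is `CongruentShaFreeCutTwoAdicSelmerFiniteCorank.finite_selmerAcBase_of_selmerCorank_eq_one_of_torsionValued`
(p433655; parts p433381/p433383), GRANTED that for each `𝔮 ∣ p` the `𝔮`-TORSION-VALUED parts
`Sel^{(p^k)}(W/K) ∩ loc_𝔮⁻¹ κ_𝔮(W(K_𝔮)_tors)` have order bounded in `k` (finite-level currency). This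
file supplies that bound from the registered `p^∞`-currency hypothesis (res), by the corank dichotomy
`rank + corank Ш = 1`: (i) `rank W(K) = 1`, `Ш[p^∞]` finite — bounded OUTRIGHT
(`exists_natCard_torsionValued_le_of_rankOne`, X11b's Part A with the torsion-valued condition; (res)
unused); (ii) `rank W(K) = 0` — the BRIDGE `natCard_torsionValued_le_mul_of_finite_points`:
`H¹(ι_k) : H¹(K, W[p^k]) → H¹(K, W[p^∞])` maps `Sel^{(p^k)}` into `Sel_{p^∞}`
(`primaryH1ToH1_map_primaryInclusion`: `(W[p^∞] ↪ W)_* ∘ H¹(ι_k) = (W[p^k] ↪ W)_*`, both Selmer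
groups being preimages of `Ш`) and a `𝔮`-torsion-valued class to a `𝔮`-STRICT one
(`κ_𝔮(W(K_𝔮)_tors) = ker(H¹(K_𝔮, W[p^k]) → H¹(K_𝔮, W[p^∞]))`, X11b, + naturality of localisation +
the K7r cell's "strict = dies on the decomposition group"); its kernel on `Sel^{(p^k)} ∩ C_𝔮` lies in
`κ_{p^k}(W(K))`, of order `≤ #W(K)`, finite in rank `0`. Hence `#(Sel^{(p^k)} ∩ C_𝔮) ≤ #W(K) ·
#(Sel_{p^∞} ∩ Str_𝔮)`, bounded by (res).

References: [Skinner2020] §2.3 Lemma 2.3.2; [JetchevSkinnerWan2017] Prop. 3.2.1; [GreenbergLNM1716] §2, §5;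
[Castella2018] Def. 2.2; [MilneADT2006] I 2.8, 4.10(b); [SilvermanAEC2009] X.4.2, VII.6.3. PARTITION: none. -/

noncomputable section

open scoped Classical

universe u

namespace Summit.BirchSwinnertonDyer.BirchSwinnertonDyer.Theorems.CongruentShaFreeCutSelmerFiniteOfRes

open WeierstrassCurve NumberField IsDedekindDomain Field Function
open Literature.NumberTheory.EllipticCurves Literature.NumberTheory.EllipticCurves.GreenbergSelmer
open Literature.NumberTheory.GaloisRepresentations Literature.NumberTheory.GaloisCohomology
open Summit.BirchSwinnertonDyer.Rank1Residual.X11b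
open Summit.BirchSwinnertonDyer.Rank1Residual.X11b.AcSelmer
open Summit.BirchSwinnertonDyer.Rank1Residual.X11b.LocBridge
open Summit.BirchSwinnertonDyer.Rank1Residual.X11b.Levels
open Summit.BirchSwinnertonDyer.Rank1Residual.X11b.SelmerLevelBound
open Summit.BirchSwinnertonDyer.BirchSwinnertonDyer.Theorems.CongruentShaFreeCutTwoAdicSelmerFinite
  (index_range_zsmul_le_mul_card_torsion finiteIndex_of_finiteIndex_torsion_sup)
open scoped ContRepresentation

/-! ## 1. `H¹(ι_k) : H¹(K, W[p^k]) → H¹(K, W[p^∞])` over `(W[p^∞] ↪ W)_*`, Selmer groups, strict places -/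

section Bridge

variable {K : Type} [Field K] (E : WeierstrassCurve K) (p k : ℕ) [Fact p.Prime]

omit [Fact p.Prime] in
/-- **`(W[p^∞] ↪ W)_* ∘ H¹(ι_k) = (W[p^k] ↪ W)_*`** on `H¹(K, ·)` (functoriality of `H¹` in the
coefficients: both sides are Mathlib's `ContinuousCohomology.map` along `(id, W[p^k] ↪ W(K̄))`; X11b's
`galoisCohomology.map (primaryInclusion W p k) 1` IS the tree's `resH1Hom (id) (W[p^k] ↪ W[p^∞])`,
definitionally). The `k = 1` case is the tree's `primaryH1ToH1_comp_torsionToPrimaryH1`.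
[cite: GreenbergLNM1716, §5 proof of Prop. 5.8] -/
theorem primaryH1ToH1_comp_map_primaryInclusion :
    (primaryH1ToH1 E p).comp (galoisCohomology.map (primaryInclusion E p k) 1) =
      torsionH1ToH1 E ((p ^ k : ℕ) : ℤ) := by
  have h : (primaryH1ToH1 E p).comp
      (resH1Hom (ContinuousMonoidHom.id (Field.absoluteGaloisGroup K))
        (AddSubgroup.inclusion (geomTorsion_pow_le_geomPrimaryTorsion E p k)) (fun _ _ ↦ rfl) :
        galH1Torsion E ((p ^ k : ℕ) : ℤ) →+ galH1Primary E p) = torsionH1ToH1 E ((p ^ k : ℕ) : ℤ) := by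
    rw [primaryH1ToH1, resH1Hom_comp, torsionH1ToH1_eq_resH1Hom]
    exact resH1Hom_congr rfl (AddMonoidHom.ext fun _ ↦ rfl) _ _
  exact h

omit [Fact p.Prime] in
/-- Pointwise form of `primaryH1ToH1_comp_map_primaryInclusion`. [cite: GreenbergLNM1716, §5 proof of Prop. 5.8] -/
theorem primaryH1ToH1_map_primaryInclusion
    (c : galoisCohomology (E.torsionGaloisModule ((p ^ k : ℕ) : ℤ)) 1) :
    primaryH1ToH1 E p (galoisCohomology.map (primaryInclusion E p k) 1 c) =
      torsionH1ToH1 E ((p ^ k : ℕ) : ℤ) c := by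
  rw [← primaryH1ToH1_comp_map_primaryInclusion E p k]
  rfl

variable [NumberField K]

/-- **`H¹(ι_k)` maps `Sel^{(p^k)}(W/K)` into `Sel_{p^∞}(W/K)`**: both are the preimages of `Ш(W/K)`
under `(W[p^k] ↪ W)_*`, resp. `(W[p^∞] ↪ W)_*` (`map_torsionH1ToH1_selmerGroup_holds`,
`selmerGroupPInfty_eq_comap_sha`), and `(W[p^∞] ↪ W)_* ∘ H¹(ι_k) = (W[p^k] ↪ W)_*`.
[cite: GreenbergLNM1716, §2 p. 63] -/
theorem map_primaryInclusion_mem_selmerGroupPInfty [E.IsElliptic]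
    {c : galoisCohomology (E.torsionGaloisModule ((p ^ k : ℕ) : ℤ)) 1}
    (hc : c ∈ selmerGroup E ((p ^ k : ℕ) : ℤ)) :
    galoisCohomology.map (primaryInclusion E p k) 1 c ∈ E.selmerGroupPInfty p := by
  have hn : ((p ^ k : ℕ) : ℤ) ≠ 0 := Int.natCast_ne_zero.mpr (pow_ne_zero k (Fact.out : p.Prime).ne_zero)
  have h : torsionH1ToH1 E ((p ^ k : ℕ) : ℤ) c ∈
      (selmerGroup E ((p ^ k : ℕ) : ℤ)).map (torsionH1ToH1 E ((p ^ k : ℕ) : ℤ)) := ⟨c, hc, rfl⟩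
  rw [E.map_torsionH1ToH1_selmerGroup_holds hn] at h
  have key : primaryH1ToH1 E p (galoisCohomology.map (primaryInclusion E p k) 1 c) ∈ E.sha := by
    rw [primaryH1ToH1_map_primaryInclusion]; exact h.1
  rw [selmerGroupPInfty_eq_comap_sha]
  exact key

/-- **`H¹(ι_k)` maps a `𝔮`-TORSION-VALUED class to a `𝔮`-STRICT one**: if `loc_𝔮 c ∈ κ_𝔮(W(K_𝔮)_tors)`
then `H¹(ι_k) c` dies in `H¹(K_𝔮, W(K̄_𝔮)[p^∞])` (`selmerLocalKerPrimaryTorsion`):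
`κ_𝔮(W(K_𝔮)_tors) = ker(H¹(K_𝔮, W[p^k]) → H¹(K_𝔮, W[p^∞]))` (X11b
`map_torsion_localKummerMap_eq_ker_map_primaryInclusion`), localisation is natural, and "dies in
`H¹(K_𝔮, W[p^∞])`" = "dies on `D_𝔮`" = the strict condition (X11b `localization_inr_eq_zero_iff`, K7r
`mem_selmerLocalKerPrimaryTorsion_adicCompletion_iff`). [cite: JetchevSkinnerWan2017, §3.3.1 (arXiv:1512.06894 p. 11)] -/
theorem map_primaryInclusion_mem_selmerLocalKerPrimaryTorsion [E.IsElliptic]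
    (𝔮 : HeightOneSpectrum (𝓞 K)) (hn : ((p ^ k : ℕ) : ℤ) ≠ 0)
    {c : galoisCohomology (E.torsionGaloisModule ((p ^ k : ℕ) : ℤ)) 1}
    (hc : c ∈ ((AddCommGroup.torsion (E.baseChange (𝔮.adicCompletion K)).toAffine.Point).map
          (E.localKummerMap (𝔮.adicCompletion K) hn)).comap
          (galoisCohomology.res (E.torsionGaloisModule ((p ^ k : ℕ) : ℤ)) (𝔮.adicCompletion K) 1)) :
    galoisCohomology.map (primaryInclusion E p k) 1 c ∈
      selmerLocalKerPrimaryTorsion E (𝔮.adicCompletion K) p := by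
  haveI : CharZero (𝔮.adicCompletion K) := charZero_adicCompletion 𝔮
  haveI := charZero_placeCompletion (K := K) (Sum.inr 𝔮)
  -- `loc_𝔮 (H¹(ι_k) c) = H¹(ι_k|_{K_𝔮}) (loc_𝔮 c) = 0`
  have h1 : galoisCohomology.localization (primaryGaloisModule E p) (Sum.inr 𝔮) 1
      (galoisCohomology.map (primaryInclusion E p k) 1 c) = 0 := by
    rw [localization_map_one]
    have hc' : galoisCohomology.localization (E.torsionGaloisModule ((p ^ k : ℕ) : ℤ)) (Sum.inr 𝔮) 1 c ∈
        (galoisCohomology.map ((primaryInclusion E p k).restrictField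
          (Place.Completion (Sum.inr 𝔮 : Place K))) 1).ker := by
      rw [← LevelKummer.map_torsion_localKummerMap_eq_ker_map_primaryInclusion E p k
        (Place.Completion (Sum.inr 𝔮 : Place K)) hn]
      exact hc
    exact (AddMonoidHom.mem_ker).mp hc'
  -- `loc_𝔮 x = 0 ⟺ x` dies on `D_𝔮 ⟺ x ∈ selmerLocalKerPrimaryTorsion`
  have h2 := (localization_inr_eq_zero_iff (isOpen_stabilizer_geomPrimaryTorsion E p) 𝔮
    (galoisCohomology.map (primaryInclusion E p k) 1 c)).mp h1
  exact (RamifiedSevenEllipticUnits.mem_selmerLocalKerPrimaryTorsion_adicCompletion_iff E p 𝔮 _).mpr h2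

/-- **The bridge (rank-`0` engine): `#(Sel^{(p^k)} ∩ loc_𝔮⁻¹ κ_𝔮(T)) ≤ #W(K) · #(Sel_{p^∞} ∩ Str_𝔮)`**
(`W(K)` finite, the `𝔮`-strict `p^∞`-Selmer group finite): `H¹(ι_k)` restricts to a homomorphism
`Sel^{(p^k)} ∩ C_𝔮 → Sel_{p^∞} ∩ Str_𝔮` whose kernel lies in `κ_{p^k}(W(K))` (a class killed by `H¹(ι_k)`
is killed by `(W[p^k] ↪ W)_*`, hence is a Kummer class). [cite: GreenbergLNM1716, §2 p. 63 and §5 proof of Prop. 5.8] -/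
theorem natCard_torsionValued_le_mul_of_finite_points [E.IsElliptic] [Finite E.toAffine.Point]
    (𝔮 : HeightOneSpectrum (𝓞 K)) (hn : ((p ^ k : ℕ) : ℤ) ≠ 0)
    [Finite ↥(E.selmerGroupPInfty p ⊓ selmerLocalKerPrimaryTorsion E (𝔮.adicCompletion K) p)] :
    Nat.card ↥(selmerGroup E ((p ^ k : ℕ) : ℤ) ⊓
        ((AddCommGroup.torsion (E.baseChange (𝔮.adicCompletion K)).toAffine.Point).map
          (E.localKummerMap (𝔮.adicCompletion K) hn)).comap
          (galoisCohomology.res (E.torsionGaloisModule ((p ^ k : ℕ) : ℤ)) (𝔮.adicCompletion K) 1)) ≤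
      Nat.card E.toAffine.Point *
        Nat.card ↥(E.selmerGroupPInfty p ⊓ selmerLocalKerPrimaryTorsion E (𝔮.adicCompletion K) p) := by
  classical
  haveI : PerfectField K := PerfectField.ofCharZero
  set n : ℕ := p ^ k with hndef
  haveI : NeZero n := ⟨pow_ne_zero _ (Fact.out : p.Prime).ne_zero⟩
  set ι := galoisCohomology.map (primaryInclusion E p k) 1 with hι
  set Sel := selmerGroup E (n : ℤ) with hSel
  set C := ((AddCommGroup.torsion (E.baseChange (𝔮.adicCompletion K)).toAffine.Point).map
      (E.localKummerMap (𝔮.adicCompletion K) hn)).comap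
    (galoisCohomology.res (E.torsionGaloisModule (n : ℤ)) (𝔮.adicCompletion K) 1) with hC
  set Tgt := E.selmerGroupPInfty p ⊓ selmerLocalKerPrimaryTorsion E (𝔮.adicCompletion K) p with hTgt
  haveI : Finite Sel := E.finite_selmerGroup_holds hn
  haveI : Finite ↥(Sel ⊓ C) := Finite.of_injective _ (AddSubgroup.inclusion_injective inf_le_left)
  -- the homomorphism `φ : Sel ⊓ C → Tgt`
  have hmem : ∀ x : ↥(Sel ⊓ C), ι x.1 ∈ Tgt := fun x ↦
    ⟨map_primaryInclusion_mem_selmerGroupPInfty E p k x.2.1,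
      map_primaryInclusion_mem_selmerLocalKerPrimaryTorsion E p k 𝔮 hn x.2.2⟩
  set φ : ↥(Sel ⊓ C) →+ ↥Tgt := (ι.comp (Sel ⊓ C).subtype).codRestrict Tgt hmem with hφ
  -- `#(Sel ⊓ C) = #ker φ · #range φ`
  have hcard : Nat.card φ.ker * Nat.card φ.range = Nat.card ↥(Sel ⊓ C) := by
    rw [← AddSubgroup.index_ker φ]
    exact AddSubgroup.card_mul_index φ.ker
  have hrange : Nat.card φ.range ≤ Nat.card ↥Tgt :=
    Nat.card_le_card_of_injective _ (AddSubgroup.subtype_injective φ.range)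
  -- `ker φ ↪ κ_n(W(K))`
  have hdiv := E.zsmul_geomPoints_surjective_holds hn
  have hker : Nat.card φ.ker ≤ Nat.card E.toAffine.Point := by
    have hk0 : ∀ x : φ.ker, torsionH1ToH1 E (n : ℤ) x.1.1 = 0 := fun x ↦ by
      have hx : φ x.1 = 0 := (AddMonoidHom.mem_ker).mp x.2
      have hx' : ι x.1.1 = 0 := by
        have := congrArg Subtype.val hx
        exact this
      have h3 : primaryH1ToH1 E p (ι x.1.1) = 0 := by
        have := congrArg (primaryH1ToH1 E p) hx'
        exact this.trans (map_zero _)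
      exact (primaryH1ToH1_map_primaryInclusion E p k x.1.1).symm.trans h3
    have hkum : ∀ x : φ.ker, ∃ P : E.toAffine.Point, kummerMapTorsion E (n : ℤ) hdiv P = x.1.1 :=
      fun x ↦ mem_range_kummerMapTorsion_of_torsionH1ToH1_eq_zero E (n : ℤ) hdiv x.1.1 (hk0 x)
    choose P hP using hkum
    refine Nat.card_le_card_of_injective P fun x y hxy ↦ ?_
    apply Subtype.ext; apply Subtype.ext
    rw [← hP x, ← hP y, hxy]
  calc Nat.card ↥(Sel ⊓ C) = Nat.card φ.ker * Nat.card φ.range := hcard.symm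
    _ ≤ Nat.card E.toAffine.Point * Nat.card ↥Tgt := Nat.mul_le_mul hker hrange

end Bridge

/-! ## 2. The torsion-valued parts are bounded at a RANK-ONE datum (no (res) needed) -/

section RankOne

/-- **`#(Sel^{(p^k)}(E/K) ∩ loc_𝔮⁻¹ κ_𝔮(E(K_𝔮)_tors)) ≤ #Ш[p^∞] · #E(K)_tors · p^{e_Q}` at a rank-one
datum** (any prime `p`, any reduction type; `W/ℚ` elliptic and globally minimal, `K` imaginary
quadratic with `p` split, `𝔮 ∣ p`). X11b's Part A with the torsion-valued condition at `𝔮`, the local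
index `[E(K_𝔮) : T + p^k] = p^k`, the global index `[E(K) : p^k] ≤ p^k · #E(K)_tors` and the image of a
generator of `E(K)/tors` in `E(ℚ_p) ⊇ ℤ_p`. [cite: JetchevSkinnerWan2017, Prop. 3.2.1 (proof, arXiv:1512.06894 pp. 10–11)]
[cite: Castella2018, proof of Thm. 2.3, (3.2.1) (arXiv:1704.06608 pp. 5–6)] -/
theorem exists_natCard_torsionValued_le_of_rankOne (W : WeierstrassCurve ℚ) [W.IsElliptic]
    [W.IsGloballyMinimal] (p : ℕ) [Fact p.Prime] (K : Type) [Field K] [NumberField K]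
    (hK : IsImaginaryQuadratic K) (hsplit : SplitsIn K p)
    (hrank : (W.baseChange K).mordellWeilRank = 1)
    (hSha : Finite (AddCommGroup.primaryComponent (W.baseChange K).sha p))
    (𝔮 : HeightOneSpectrum (𝓞 K)) (h𝔮 : ((p : ℕ) : 𝓞 K) ∈ 𝔮.asIdeal) :
    ∃ B : ℕ, ∀ k : ℕ, 0 < k →
      Nat.card ↥(selmerGroup (W.baseChange K) ((p ^ k : ℕ) : ℤ) ⊓
        ((AddCommGroup.torsion
            ((W.baseChange K).baseChange (𝔮.adicCompletion K)).toAffine.Point).map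
          ((W.baseChange K).localKummerMap (𝔮.adicCompletion K)
            (Int.natCast_ne_zero.mpr (pow_ne_zero k (Fact.out : p.Prime).ne_zero)))).comap
          (galoisCohomology.res ((W.baseChange K).torsionGaloisModule ((p ^ k : ℕ) : ℤ))
            (𝔮.adicCompletion K) 1)) ≤ B := by
  set E := W.baseChange K with hEdef
  set G := W.baseChange ℚ_[p] with hGdef
  haveI hEK : E.IsElliptic := by rw [hEdef, baseChange]; infer_instance
  haveI : PerfectField K := PerfectField.ofCharZero
  haveI : CharZero (𝔮.adicCompletion K) := charZero_adicCompletion 𝔮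
  have h2 : Module.finrank ℚ K = 2 := hK.1
  have hp : p.Prime := Fact.out
  haveI := hSha
  obtain ⟨he, hf⟩ := degreeOne_of_splitsIn h2 hsplit h𝔮
  set ιp := embAt K p 𝔮 h𝔮 he hf with hιp
  set f : E.toAffine.Point →+ G.toAffine.Point := Affine.Point.map (W' := W) ιp.toRatAlgHom with hfdef
  have hfinj : Function.Injective f := Affine.Point.map_injective (W' := W) ιp.toRatAlgHom
  -- a coordinate `c : E(K) → ℤ` and a generator `Q` of `E(K)/tors`
  obtain ⟨c, Q, hcQ, hcker⟩ := RankOne.exists_coord_of_mordellWeilRank_eq_one E hrank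
  have hQinf : ¬ IsOfFinAddOrder Q := fun hQ => by
    have h := RankOne.coord_eq_zero_of_isOfFinAddOrder c hQ
    rw [hcQ] at h
    exact one_ne_zero h
  have hxinf : ¬ IsOfFinAddOrder (f Q) := fun hx => hQinf ((hfinj.isOfFinAddOrder_iff).mp hx)
  haveI hTK : Finite (AddCommGroup.torsion E.toAffine.Point) := E.finite_torsion_point
  set t := Nat.card (AddCommGroup.torsion E.toAffine.Point) with htdef
  -- the `ℤ_p`-coordinate on `E(ℚ_p)`
  haveI hfi2 : (G.formalFiltration 2).FiniteIndex := G.finiteIndex_formalFiltration 2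
  obtain ⟨φ, -⟩ := LocalIndex.exists_addEquiv_valuation_psi_padicPointOf W p (K := K)
  obtain ⟨m, hmrange, hmcard, hmle⟩ :=
    LocalIndex.exists_pow_eq_card_and_le_valuation_psi (G.formalFiltration 2) φ
  set Ψ := LocalIndex.psi (G.formalFiltration 2) φ with hΨ
  set eQ := (Ψ (f Q)).valuation with heQdef
  have hΨQ : Ψ (f Q) ≠ 0 := fun h0 => hxinf ((LocalIndex.psi_eq_zero_iff _ φ _).mp h0)
  have hmeQ : m ≤ eQ := hmle (f Q) hΨQ
  haveI hTG : Finite (AddCommGroup.torsion G.toAffine.Point) :=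
    LocalIndex.finite_torsion (G.formalFiltration 2) φ
  -- `#Ш[p^∞]`
  set S := Nat.card (AddCommGroup.primaryComponent E.sha p) with hSdef
  refine ⟨S * (t * p ^ eQ), fun k hk ↦ ?_⟩
  haveI : NeZero (p ^ k) := ⟨pow_ne_zero _ hp.ne_zero⟩
  have hnZ : ((p ^ k : ℕ) : ℤ) ≠ 0 := Int.natCast_ne_zero.mpr (pow_ne_zero k hp.ne_zero)
  -- the subgroups of `E(ℚ_p)` at level `k`
  set Tq : AddSubgroup G.toAffine.Point := AddCommGroup.torsion G.toAffine.Point with hTq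
  set Pk : AddSubgroup G.toAffine.Point :=
    (nsmulAddMonoidHom (p ^ k) : G.toAffine.Point →+ _).range with hPk
  set H₀ : AddSubgroup G.toAffine.Point := Pk ⊔ AddSubgroup.zmultiples (f Q) with hH₀
  have hTH₀ : (Tq ⊔ H₀).index = p ^ min k (eQ - m) :=
    LocalIndex.index_torsion_sup_range_nsmul_sup_zmultiples (G.formalFiltration 2) φ hmrange
      (f Q) hxinf k
  have hfQ : AddSubgroup.zmultiples (f Q) ≤ f.range := by
    rw [AddSubgroup.zmultiples_le]; exact ⟨Q, rfl⟩
  have hmin : p ^ min k (eQ - m) ≤ p ^ (eQ - m) := Nat.pow_le_pow_right hp.pos (min_le_right _ _)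
  have hpow : p ^ (eQ - m) * p ^ m = p ^ eQ := by rw [← pow_add, Nat.sub_add_cancel hmeQ]
  -- `M = p^k`
  have hM : (AddCommGroup.torsion ((W.baseChange K).baseChange (𝔮.adicCompletion K)).toAffine.Point ⊔
      (zsmulAddGroupHom ((p ^ k : ℕ) : ℤ) :
        ((W.baseChange K).baseChange (𝔮.adicCompletion K)).toAffine.Point →+ _).range).index =
      p ^ k := by
    rw [index_torsion_sup_range_zsmul_eq_padic K p 𝔮 h𝔮 he hf W,
      RankOne.range_zsmulAddGroupHom_natCast]
    exact LocalIndex.index_torsion_sup_range_nsmul (G.formalFiltration 2) φ k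
  -- `N ≤ p^k · #E(K)_tors`
  have hN : ((zsmulAddGroupHom ((p ^ k : ℕ) : ℤ) : E.toAffine.Point →+ _).range).index ≤
      p ^ k * t := index_range_zsmul_le_mul_card_torsion c Q hcQ hcker (p ^ k)
  -- `L₂ ≤ p^{eQ}`
  have hL₂ : ((Affine.Point.baseChange (W' := W.baseChange K) K (𝔮.adicCompletion K)).range ⊔
      (AddCommGroup.torsion ((W.baseChange K).baseChange (𝔮.adicCompletion K)).toAffine.Point ⊔
        (zsmulAddGroupHom ((p ^ k : ℕ) : ℤ) :
          ((W.baseChange K).baseChange (𝔮.adicCompletion K)).toAffine.Point →+ _).range)).index ≤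
      p ^ eQ := by
    rw [index_range_baseChange_sup_torsion_sup_eq_padic K p 𝔮 h𝔮 he hf W,
      RankOne.range_zsmulAddGroupHom_natCast]
    change (f.range ⊔ (Tq ⊔ Pk)).index ≤ _
    have hle : Tq ⊔ H₀ ≤ f.range ⊔ (Tq ⊔ Pk) := by
      refine sup_le (le_sup_right.trans' le_sup_left) (sup_le ?_ ?_)
      · exact le_sup_right.trans' le_sup_right
      · exact hfQ.trans le_sup_left
    haveI : (Tq ⊔ H₀).FiniteIndex := ⟨by rw [hTH₀]; exact pow_ne_zero _ hp.ne_zero⟩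
    calc (f.range ⊔ (Tq ⊔ Pk)).index ≤ (Tq ⊔ H₀).index := AddSubgroup.index_antitone hle
      _ = p ^ min k (eQ - m) := hTH₀
      _ ≤ p ^ (eQ - m) := hmin
      _ ≤ p ^ (eQ - m) * p ^ m := Nat.le_mul_of_pos_right _ (pow_pos hp.pos _)
      _ = p ^ eQ := hpow
  -- `#(Ш ∩ H¹(K,E)[p^k]) ≤ #Ш[p^∞]`
  have hS : Nat.card ↥(E.sha ⊓ AddSubgroup.torsionBy E.galH1 ((p ^ k : ℕ) : ℤ)) ≤ S :=
    (SelmerCount.natCard_sha_inf_torsionBy_le_of_finite E p k).2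
  -- Part A with the torsion-valued condition at `𝔮`
  have hdiv := E.zsmul_geomPoints_surjective_holds hnZ
  have hA := StrictAtPlace.natCard_selmerGroup_inf_comap_mul_index_le E (𝔮.adicCompletion K) hnZ
    hdiv (AddCommGroup.torsion (E.baseChange (𝔮.adicCompletion K)).toAffine.Point)
  rw [hM] at hA
  -- cancel `p^k`
  have hkey : Nat.card ↥(selmerGroup E ((p ^ k : ℕ) : ℤ) ⊓
        ((AddCommGroup.torsion (E.baseChange (𝔮.adicCompletion K)).toAffine.Point).map
          (E.localKummerMap (𝔮.adicCompletion K) hnZ)).comap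
          (galoisCohomology.res (E.torsionGaloisModule ((p ^ k : ℕ) : ℤ)) (𝔮.adicCompletion K) 1)) *
        p ^ k ≤ S * (t * p ^ eQ) * p ^ k := by
    calc _ ≤ Nat.card ↥(E.sha ⊓ AddSubgroup.torsionBy E.galH1 ((p ^ k : ℕ) : ℤ)) *
          (((zsmulAddGroupHom ((p ^ k : ℕ) : ℤ) : E.toAffine.Point →+ _).range).index *
            ((Affine.Point.baseChange (W' := W.baseChange K) K (𝔮.adicCompletion K)).range ⊔
              (AddCommGroup.torsion ((W.baseChange K).baseChange (𝔮.adicCompletion K)).toAffine.Point ⊔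
                (zsmulAddGroupHom ((p ^ k : ℕ) : ℤ) :
                  ((W.baseChange K).baseChange (𝔮.adicCompletion K)).toAffine.Point →+ _).range)).index) :=
          hA
      _ ≤ S * ((p ^ k * t) * p ^ eQ) := Nat.mul_le_mul hS (Nat.mul_le_mul hN hL₂)
      _ = S * (t * p ^ eQ) * p ^ k := by ring
  exact Nat.le_of_mul_le_mul_right hkey (pow_pos hp.pos k)

end RankOne

/-! ## 3. The registered stub -/

section Stub

/-- **`stub_selmerAcBaseFinite_of_resCorankOne`** (REGISTERED on stmt-BirchSwinnertonDyer-19079 and,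
token-identically, on stmt-BirchSwinnertonDyer-19159; line `heegner-field-links` v5, plan g11
2026-08-26T08:34Z). For an elliptic, globally minimal `W/ℚ`, ANY prime `p`, an imaginary quadratic `K`
in which `p` splits, granted Poitou–Tate reciprocity (`hPT`, Milne ADT I 4.10(b)/2.3) and Tate's local
Euler–Poincaré characteristic (`hEP`, Milne I 2.8 — a tree theorem) at `K`: if
`corank_{ℤ_p} Sel_{p^∞}(W/K) = 1` and the `w`-strict Selmer group
`Sel_{p^∞}(W/K) ∩ ker(H¹(K, W[p^∞]) → H¹(K_w, W(K̄_w)[p^∞]))` is finite at every `w ∣ p` («(res)»,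
Skinner 2020 Thm. B's hypothesis), then Castella's base Selmer group `Sel_𝔭(K, W[p^∞])`
(`X11b.AcSelmer.selmerAcBase (W_K) p 𝔭 ∅`: strict at `𝔭`, relaxed at `𝔭̄`, trivial off `p`) is
FINITE at every `𝔭 ∋ p`. Proof: `finite_selmerAcBase_of_selmerCorank_eq_one_of_torsionValued` fed, for each
`𝔮 ∣ p`, with a `k`-uniform bound on the `𝔮`-torsion-valued parts of `Sel^{(p^k)}(W/K)`: rank `1` and
`Ш[p^∞]` finite ⟹ `exists_natCard_torsionValued_le_of_rankOne`; rank `0` ⟹ `W(K)` finite and the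
bridge `natCard_torsionValued_le_mul_of_finite_points`, bounded by (res). Skinner 2020 Lemma 2.3.2 in
discrete currency; corank-currency twin of `finite_selmerAcBase_of_rankOne` (s2-c3 g3, p429679).
CONDITIONAL on `hPT`/`hEP` as registered; credits nothing about (res), Link B, the cruxes or BSD.
[cite: Skinner2020, §2.3 Lemma 2.3.2 (arXiv:1405.7294 p. 8)]
[cite: JetchevSkinnerWan2017, Prop. 3.2.1 (proof, arXiv:1512.06894 pp. 10–11)]
[cite: MilneADT2006, Ch. I, Thm. 4.10(b) and Thm. 2.8] [cite: GreenbergLNM1716, §2 p. 63, §5 proof of Prop. 5.8] -/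
theorem stub_selmerAcBaseFinite_of_resCorankOne :
    ∀ (W : WeierstrassCurve ℚ) [W.IsElliptic] [W.IsGloballyMinimal] (p : ℕ) [Fact p.Prime]
      (K : Type) [Field K] [NumberField K],
      poitouTate_sum_localTatePairing_eq_zero K →
      (∀ v : HeightOneSpectrum (𝓞 K), localEulerPoincareCharacteristic (v.adicCompletion K)) →
      IsImaginaryQuadratic K → Summit.BirchSwinnertonDyer.Rank1Residual.X11b.SplitsIn K p →
      (W.baseChange K).selmerCorank p = 1 →
      (∀ (w : HeightOneSpectrum (𝓞 K)), ((p : ℕ) : 𝓞 K) ∈ w.asIdeal →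
        Finite ↥((W.baseChange K).selmerGroupPInfty p ⊓
          selmerLocalKerPrimaryTorsion (W.baseChange K) (w.adicCompletion K) p)) →
      ∀ (𝔭 : HeightOneSpectrum (𝓞 K)), ((p : ℕ) : 𝓞 K) ∈ 𝔭.asIdeal →
        Finite (Summit.BirchSwinnertonDyer.Rank1Residual.X11b.AcSelmer.selmerAcBase (W.baseChange K) p 𝔭 ∅) := by
  intro W _ _ p _ K _ _ hPT hEP hK hsplit hcork hres 𝔭 h𝔭
  refine CongruentShaFreeCutTwoAdicSelmerFiniteCorank.finite_selmerAcBase_of_selmerCorank_eq_one_of_torsionValued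
    W p K hPT hEP hK hsplit hcork (fun 𝔮 h𝔮 ↦ ?_) 𝔭 h𝔭
  haveI hEK : (W.baseChange K).IsElliptic := by rw [baseChange]; infer_instance
  have hadd := (W.baseChange K).selmerCorank_eq_mordellWeilRank_add_holds p
  rw [hcork] at hadd
  rcases Nat.eq_zero_or_pos (W.baseChange K).mordellWeilRank with h0 | hpos
  · -- rank `0`: `W(K)` finite; the bridge, bounded by (res)
    haveI : Module.Finite ℤ (W.baseChange K).toAffine.Point := (W.baseChange K).module_finite_point_holds
    haveI : Finite (W.baseChange K).toAffine.Point :=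
      (W.baseChange K).finite_point_of_mordellWeilRank_eq_zero h0
    haveI := hres 𝔮 h𝔮
    exact ⟨Nat.card (W.baseChange K).toAffine.Point *
        Nat.card ↥((W.baseChange K).selmerGroupPInfty p ⊓
          selmerLocalKerPrimaryTorsion (W.baseChange K) (𝔮.adicCompletion K) p),
      fun k _ ↦ natCard_torsionValued_le_mul_of_finite_points (W.baseChange K) p k 𝔮 _⟩
  · -- rank `1`: `Ш[p^∞]` finite; the torsion-valued parts are bounded outright
    have hrank : (W.baseChange K).mordellWeilRank = 1 := by omega
    have hsha0 : (W.baseChange K).shaCorank p = 0 := by omega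
    have hSha : Finite (AddCommGroup.primaryComponent (W.baseChange K).sha p) :=
      (finite_primaryComponent_sha_iff_shaCorank_eq_zero (W.baseChange K) p).mpr hsha0
    exact exists_natCard_torsionValued_le_of_rankOne W p K hK hsplit hrank hSha 𝔮 h𝔮

end Stub

end Summit.BirchSwinnertonDyer.BirchSwinnertonDyer.Theorems.CongruentShaFreeCutSelmerFiniteOfRes

end
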